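import Literature.NumberTheory.Automorphic.LanglandsTetrahedral
import Literature.NumberTheory.Automorphic.PairLFunctionBaseChange
import Literature.NumberTheory.GaloisRepresentations.HeckeCharacter
import HarnessLib

/-!
# Selfdual cusp forms on `GL(3)` are adjoint lifts from `GL(2)` (Ramakrishnan 2014)

Topic `NumberTheory/Automorphic` (family `lang`). One named fact (D-0014) and its proved API.

Ramakrishnan, *An exercise concerning the selfdual cusp forms on GL(3)* (2014), Theorem A:
"Let `F` be a number field, and `Π` a cuspidal, selfdual automorphic representation of
`GL_3(𝔸_F)`. Then there exists a non-dihedral cusp form `π` on `GL(2)/F`, and an idele class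
character `ν` of `F` with `ν² = 1`, such that `Π ≃ Ad(π) ⊗ ν`. The form `π` is unique up to a
character twist, while `ν` is simply the central character of `Π`. The central character `ω` of
`π` may be chosen to be of finite order. Moreover, we may choose `π` such that, for any finite
place `v`, `π_v` is unramified, resp. Steinberg, when `Π_v ⊗ ν_v` is unramified, resp. Steinberg."
Here `Ad(π) = sym²(π) ⊗ ω⁻¹` is the Gelbart–Jacquet lift; the printed proof goes through the pole
of `L^S(s, Π; sym²)` at `s = 1`, the Ginzburg–Rallis–Soudry descent `GL(3) → SO(3) ≅ PGL(2)`,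
i.e. to `SL(2)`, the transfer back of Cogdell–Kim–Piatetski-Shapiro–Shahidi, Labesse–Langlands
(`SL(2) → GL(2)`) and multiplicity one for `SL(2)`. The Note adds (p. 777): "Theorem A remains
valid for any cusp form `Π` on `GL(3)/F` which satisfies `Π^∨ ≃ Π ⊗ |·|^t` for some `t`, the
reason being that we may replace `Π` by `Π ⊗ |·|^{t/2}`, which is selfdual"; the same twisting
argument for an arbitrary Hecke character `η` in place of `|·|^t` is printed as the proof of
Shavali, *On the image of automorphic Galois representations* (IMRN 2026; arXiv:2502.10799),
Lemma 4.7 ("`π` is essentially `sym²` if and only if there exist a Hecke character `χ` such that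
`π = π^∨ ⊗ χ`": comparing central characters, `χ³ = ω²`, so `χ = (ω χ⁻¹)²` has a square root,
"by twisting out this square root we can assume that `π` is self-dual. Now the result follows
from [Ramakrishnan 2014]").

* `Ramakrishnan2014_selfdualGL3_adjointLift` — the named fact, in the **essentially selfdual**
  form and, as everywhere in this topic (`GelbartJacquet_adjoint_lift`, `IsQuadraticSelfTwistAE`,
  `IsWeakBaseChangeLiftAE`), at the level of Satake parameters at almost all finite places:
  if `Π` is cuspidal on `GL_3(𝔸_F)` and `t_{Π,v}⁻¹ = η(ϖ_v) t_{Π,v}` for almost all `v`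
  (the unramified shadow of `Π^∨ ≅ Π ⊗ η`), then there are a cuspidal `π` on `GL_2(𝔸_F)` which is
  not an a.e. self-twist by any quadratic `ε_{K/F}` (non-dihedral) and a Hecke character `ν` with
  `ν² η = 1` and `t_{Π,v} = ν(ϖ_v) · Ad(t_{π,v})` (`adParams`) for almost all `v`.
* `Ramakrishnan2014_selfdualGL3_adjointLift.selfdual` — **proved** specialisation `η = 1`:
  Theorem A as printed (`ν² = 1`).
* `Ramakrishnan2014_selfdualGL3_adjointLift.satake_eq` — **proved**: the same conclusion in the
  "compare two given Satake parameters" form used by route statements, from uniqueness of Satake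
  parameters (`AutomorphicRepData.hasSatakeParamAt_unique`, a hypothesis).
* `one_mem_rsData_self`, `adParams_add_singleton_one` — **proved** bookkeeping:
  `Ad(β) + {1} = β ⊗ β⁻¹` (`satakeTensor β (β.map (·⁻¹))`) for `β ≠ 0` without zero entries, the
  dictionary between `adParams` and the `satakeTensor` carrier of `PairLFunctionBaseChange`.

## Faithfulness notes

* Hypothesis. "`Π` selfdual" (`Π^∨ ≅ Π`), resp. "`Π^∨ ≅ Π ⊗ η`", is stated through its unramified
  shadow `{α⁻¹ : α ∈ t_{Π,v}} = {η(ϖ_v) α : α ∈ t_{Π,v}}` for almost all `v` (the Satake parameter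
  of the contragredient is the inverse class, Gelfand–Kazhdan; that of `Π ⊗ η` is `η(ϖ_v) t_{Π,v}`
  at places where `η` is unramified); for cuspidal `Π` the shadow is equivalent to the isomorphism
  by strong multiplicity one (Jacquet–Shalika 1981, Thm. 4.8), exactly as for
  `IsQuadraticSelfTwistAE`.
* Conclusion. "`Π ≃ Ad(π) ⊗ ν`" is stated as `t_{Π,v} = ν(ϖ_v) Ad(t_{π,v})` at almost every `v`
  at which `π` is unramified (with `ν` unramified there; Hecke characters are unramified almost
  everywhere, Tate), the form of `GelbartJacquet_adjoint_lift`; "non-dihedral" (not automorphically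
  induced from a quadratic extension, equivalently `π ≇ π ⊗ ε_{K/F}` for every quadratic `K/F`,
  Labesse–Langlands) is stated through `IsQuadraticSelfTwistAE` as in `GelbartJacquet_adjoint_lift`.
  The relation `ν² η = 1` is what "`ν² = 1`, `ν = ω_Π`" of Theorem A becomes after the twist:
  with `ω = ω_Π`, `μ := (ω η)⁻¹` satisfies `μ² = η` (from `η³ = ω⁻²`, the determinant of the
  hypothesis), `Π ⊗ μ` is selfdual, Theorem A gives `Π ⊗ μ ≃ Ad(π) ⊗ ν₁` with `ν₁² = 1`, and
  `ν = ν₁ μ⁻¹` has `ν² η = μ⁻² η = 1` (identities of Hecke characters from their values at almost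
  all uniformizers: strong multiplicity one for `GL(1)`).
* Not vendored (printed refinements of Theorem A with no carrier in the tree, or not needed by any
  requester): uniqueness of `π` up to twist (multiplicity one for `SL(2)`), the finite order of
  `ω_π`, the matching of unramified/Steinberg local components at *every* finite place, and
  Corollary B (regularity and, over totally real `F`, algebraicity of `π`).
* Mathlib has no automorphic representations; the carriers are the tree's
  `CuspidalAutomorphicRepData`, `AutomorphicRepData.HasSatakeParamAt` (`AutomorphicRepsGL`),
  `HeckeCharacter` (`IsUnramifiedAt`, `valueAtUniformizer`), `adParams`, `IsQuadraticSelfTwistAE`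
  (`LanglandsTetrahedral`), `satakeTensor` (`PairLFunctionBaseChange`). `lean search` for
  `selfdual|SelfDual|sym2|adjoint_lift|Ramakrishnan`: only `GelbartJacquet_adjoint_lift` (the
  forward lift) and the barrier file `Barriers/Langlands/TwistedEndoscopySelfDual` exist; no
  descent `GL(3) → GL(2)` statement is in the tree.

## References

* D. Ramakrishnan, *An exercise concerning the selfdual cusp forms on GL(3)*, Indian J. Pure
  Appl. Math. 45 (2014), no. 5, 777–785, Theorem A and the remark following it (p. 777).
  [Ramakrishnan2014]
* A. Shavali, *On the image of automorphic Galois representations*, Int. Math. Res. Not. IMRN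
  2026, no. 8 (arXiv:2502.10799), Lemma 4.7 and its proof. [Shavali2026]
* S. Gelbart, H. Jacquet, *A relation between automorphic representations of GL(2) and GL(3)*,
  Ann. Sci. ÉNS 11 (1978), Thm. (9.3). [GelbartJacquet1978]
* D. Ginzburg, S. Rallis, D. Soudry, *On explicit lifts of cusp forms from GL_m to classical
  groups*, Ann. of Math. 150 (1999), 807–866.
* J.-P. Labesse, R. P. Langlands, *L-indistinguishability for SL(2)*, Canad. J. Math. 31 (1979).
* H. Jacquet, J. Shalika, *On Euler products and the classification of automorphic forms I, II*,
  Amer. J. Math. 103 (1981), Thm. 4.8. [JacquetShalika1981]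
-/

noncomputable section

open scoped MatrixGroups NumberField
open NumberField IsDedekindDomain Filter

open scoped Classical

namespace Literature.NumberTheory.Automorphic

open Literature.NumberTheory.GaloisRepresentations (HeckeCharacter)

/-! ### The named fact -/

/-- **Selfdual cusp forms on `GL(3)` are twists of adjoint lifts from `GL(2)`** (Ramakrishnan
2014, Theorem A: "Let `F` be a number field, and `Π` a cuspidal, selfdual automorphic
representation of `GL_3(𝔸_F)`. Then there exists a non-dihedral cusp form `π` on `GL(2)/F`, and
an idele class character `ν` of `F` with `ν² = 1`, such that `Π ≃ Ad(π) ⊗ ν`. … `ν` is simply the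
central character of `Π`", `Ad(π) = sym²(π) ⊗ ω_π⁻¹` the Gelbart–Jacquet lift; together with the
remark following it — "Theorem A remains valid for any cusp form `Π` on `GL(3)/F` which satisfies
`Π^∨ ≃ Π ⊗ |·|^t` … we may replace `Π` by `Π ⊗ |·|^{t/2}`, which is selfdual" — and, for a
general Hecke character `η` in place of `|·|^t`, the proof of Shavali 2026, Lemma 4.7: from
`Π^∨ ≃ Π ⊗ η` the central characters give `η³ = ω_Π⁻²`, so `η = μ²` with `μ = (ω_Π η)⁻¹`,
`Π ⊗ μ` is selfdual and Theorem A applies to it).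
Satake-level form (see the module docstring): for `F` a number field, `Π` cuspidal on
`GL_3(𝔸_F)` and `η` a Hecke character of `F` such that for almost all finite `v` and every Satake
parameter `α` of `Π` at `v`, `η` is unramified at `v` and `{a⁻¹ : a ∈ α} = {η(ϖ_v) a : a ∈ α}`
(the unramified shadow of `Π^∨ ≃ Π ⊗ η`), there exist a cuspidal `π` on `GL_2(𝔸_F)` which is for
no quadratic extension `K/F` an a.e. self-twist by `ε_{K/F}` (non-dihedral,
`IsQuadraticSelfTwistAE`) and a Hecke character `ν` of `F` with `ν² η = 1` such that for almost
all `v` and every Satake parameter `β` of `π` at `v`, `ν` is unramified at `v` and `Π` has Satake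
parameter `ν(ϖ_v) · Ad(β)` (`adParams β = {b/b', b'/b, 1}`) at `v`. Named fact (D-0014).
[cite: Ramakrishnan2014, Theorem A and the remark following it, p. 777]
[cite: Shavali2026, Lemma 4.7 (proof)] -/
def Ramakrishnan2014_selfdualGL3_adjointLift : Prop :=
  ∀ (F : Type) [Field F] [NumberField F] (hF2 : isCompact_glFiniteIntegralLevel 2 F)
    (hF3 : isCompact_glFiniteIntegralLevel 3 F) (P : CuspidalAutomorphicRepData 3 F hF3)
    (η : HeckeCharacter F),
    (∀ᶠ v : HeightOneSpectrum (𝓞 F) in Filter.cofinite, ∀ α : Multiset ℂ,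
        P.1.HasSatakeParamAt v α →
          η.IsUnramifiedAt v ∧
            α.map (fun a => a⁻¹) = α.map (fun a => η.valueAtUniformizer v * a)) →
    ∃ (π : CuspidalAutomorphicRepData 2 F hF2) (ν : HeckeCharacter F),
      (∀ (K : Type) [Field K] [NumberField K] [Algebra F K], Module.finrank F K = 2 →
          ¬ IsQuadraticSelfTwistAE K π.1) ∧
      ν ^ 2 * η = 1 ∧
      ∀ᶠ v : HeightOneSpectrum (𝓞 F) in Filter.cofinite, ∀ β : Multiset ℂ,
        π.1.HasSatakeParamAt v β →
          ν.IsUnramifiedAt v ∧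
            P.1.HasSatakeParamAt v ((adParams β).map fun c => ν.valueAtUniformizer v * c)

/-! ### Proved API -/

namespace Ramakrishnan2014_selfdualGL3_adjointLift

variable {F : Type} [Field F] [NumberField F]

/-- The trivial Hecke character is unramified everywhere. [folklore] -/
theorem one_isUnramifiedAt (v : HeightOneSpectrum (𝓞 F)) : (1 : HeckeCharacter F).IsUnramifiedAt v :=
  fun _ => rfl

/-- The trivial Hecke character takes the value `1` at every uniformizer. [folklore] -/
theorem one_valueAtUniformizer (v : HeightOneSpectrum (𝓞 F)) :
    (1 : HeckeCharacter F).valueAtUniformizer v = 1 :=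
  rfl

/-- **Theorem A as printed (the selfdual case `η = 1`).** If `Π` is cuspidal on `GL_3(𝔸_F)` with
`{a⁻¹ : a ∈ t_{Π,v}} = t_{Π,v}` for almost all `v` (the unramified shadow of `Π^∨ ≃ Π`), then
`t_{Π,v} = ν(ϖ_v) Ad(t_{π,v})` a.e. for a non-dihedral cuspidal `π` on `GL_2(𝔸_F)` and a Hecke
character `ν` with `ν² = 1`. Ramakrishnan 2014, Theorem A. [cite: Ramakrishnan2014, Theorem A] -/
theorem selfdual (h : Ramakrishnan2014_selfdualGL3_adjointLift)
    (hF2 : isCompact_glFiniteIntegralLevel 2 F) {hF3 : isCompact_glFiniteIntegralLevel 3 F}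
    (P : CuspidalAutomorphicRepData 3 F hF3)
    (hsd : ∀ᶠ v : HeightOneSpectrum (𝓞 F) in Filter.cofinite, ∀ α : Multiset ℂ,
      P.1.HasSatakeParamAt v α → α.map (fun a => a⁻¹) = α) :
    ∃ (π : CuspidalAutomorphicRepData 2 F hF2) (ν : HeckeCharacter F),
      (∀ (K : Type) [Field K] [NumberField K] [Algebra F K], Module.finrank F K = 2 →
          ¬ IsQuadraticSelfTwistAE K π.1) ∧
      ν ^ 2 = 1 ∧
      ∀ᶠ v : HeightOneSpectrum (𝓞 F) in Filter.cofinite, ∀ β : Multiset ℂ,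
        π.1.HasSatakeParamAt v β →
          ν.IsUnramifiedAt v ∧
            P.1.HasSatakeParamAt v ((adParams β).map fun c => ν.valueAtUniformizer v * c) := by
  have hsd' : ∀ᶠ v : HeightOneSpectrum (𝓞 F) in Filter.cofinite, ∀ α : Multiset ℂ,
      P.1.HasSatakeParamAt v α →
        (1 : HeckeCharacter F).IsUnramifiedAt v ∧
          α.map (fun a => a⁻¹) = α.map (fun a => (1 : HeckeCharacter F).valueAtUniformizer v * a) := by
    filter_upwards [hsd] with v hv α hα
    refine ⟨one_isUnramifiedAt v, ?_⟩
    rw [hv α hα]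
    simp [one_valueAtUniformizer]
  obtain ⟨π, ν, hnd, hν, hsat⟩ := h F hF2 hF3 P 1 hsd'
  exact ⟨π, ν, hnd, by simpa using hν, hsat⟩

/-- **The conclusion in "two given Satake parameters" form.** Under uniqueness of Satake
parameters of `Π` (`AutomorphicRepData.hasSatakeParamAt_unique`, Flath), the a.e. statement
"`Π` has Satake parameter `ν(ϖ_v) Ad(β)` whenever `π` has `β`" yields
"`α = ν(ϖ_v) Ad(β)` whenever `Π` has `α` and `π` has `β`" — the shape used by route statements.
[folklore] -/
theorem satake_eq {hF2 : isCompact_glFiniteIntegralLevel 2 F}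
    {hF3 : isCompact_glFiniteIntegralLevel 3 F} {P : CuspidalAutomorphicRepData 3 F hF3}
    {π : CuspidalAutomorphicRepData 2 F hF2} {ν : HeckeCharacter F}
    (huniq : P.1.hasSatakeParamAt_unique)
    (hsat : ∀ᶠ v : HeightOneSpectrum (𝓞 F) in Filter.cofinite, ∀ β : Multiset ℂ,
      π.1.HasSatakeParamAt v β →
        ν.IsUnramifiedAt v ∧
          P.1.HasSatakeParamAt v ((adParams β).map fun c => ν.valueAtUniformizer v * c)) :
    ∀ᶠ v : HeightOneSpectrum (𝓞 F) in Filter.cofinite, ∀ α β : Multiset ℂ,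
      P.1.HasSatakeParamAt v α → π.1.HasSatakeParamAt v β →
        ν.IsUnramifiedAt v ∧ α = (adParams β).map fun c => ν.valueAtUniformizer v * c := by
  filter_upwards [hsat] with v hv α β hα hβ
  exact ⟨(hv β hβ).1, huniq hα (hv β hβ).2⟩

end Ramakrishnan2014_selfdualGL3_adjointLift

/-! ### `Ad(β) + {1} = β ⊗ β⁻¹`: the dictionary between `adParams` and `satakeTensor` -/

/-- `1 ∈ {b b'⁻¹ : b, b' ∈ β}` as soon as `β` has a non-zero entry. [folklore] -/
theorem one_mem_rsData_self {β : Multiset ℂ} {b : ℂ} (hb : b ∈ β) (hb0 : b ≠ 0) :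
    (1 : ℂ) ∈ rsData β β := by
  refine Multiset.mem_map.mpr ⟨(b, b), ?_, mul_inv_cancel₀ hb0⟩
  exact Multiset.mem_product.mpr ⟨hb, hb⟩

/-- `β ⊗ β⁻¹ = {b b'⁻¹}`: the Rankin–Selberg data of `β` against itself is the tensor of `β`
with the inverse multiset. [folklore] -/
theorem satakeTensor_map_inv (β γ : Multiset ℂ) :
    satakeTensor β (γ.map fun b => b⁻¹) = rsData β γ := by
  induction β using Multiset.induction_on with
  | empty => simp [rsData_zero]
  | cons a s ih =>
      rw [rsData_cons, ← ih]
      simp [satakeTensor, Multiset.cons_product, Multiset.map_map]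

/-- **`Ad(β) + {1} = β ⊗ β⁻¹`** for a multiset `β ≠ 0` without zero entries (e.g. a Satake
parameter of `GL_2`, `β = {b, b'}`: `{b/b', b'/b, 1} + {1} = {1, b/b', b'/b, 1}`): the
dictionary between the carrier `adParams` of the adjoint lift (`LanglandsTetrahedral`,
`GelbartJacquet_adjoint_lift`) and the carrier `satakeTensor β (β.map (·⁻¹))` of
`PairLFunctionBaseChange`. [folklore] -/
theorem adParams_add_singleton_one {β : Multiset ℂ} (hβ : β ≠ 0) (h0 : (0 : ℂ) ∉ β) :
    adParams β + {1} = satakeTensor β (β.map fun b => b⁻¹) := by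
  obtain ⟨b, hb⟩ := Multiset.exists_mem_of_ne_zero hβ
  have hb0 : b ≠ 0 := fun h => h0 (h ▸ hb)
  have h1 : (1 : ℂ) ∈ rsData β β := one_mem_rsData_self hb hb0
  rw [satakeTensor_map_inv, Multiset.add_comm, Multiset.singleton_add]
  exact Multiset.cons_erase h1

end Literature.NumberTheory.Automorphic
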